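import Summits.QuantumFields.YangMills.Theorems.Instrument.ClosedComplexTailBound
import HarnessLib

/-!
# Instrument cell `ym-instrument`, crew (b), task (U)∕R″ (d): the DEGREE-CHARGED KRAFT MACHINE — the exploration of `ClosedComplexExploration` ∕ `ClosedComplexTailBound` re-run
# with a WEIGHT `g(deg ℓ)` on the final degree of every decided link, for ARBITRARY block parameters `(x, y, g)` satisfying the 28 block inequalities

QUESTIONS.md: Q-B1 ∕ P-B7 (sc-ref's Lemma R″ (d), R-DOUBLEPRIME.md 1058aa987410813e: «TAIL — the DEGREE-CHARGED KRAFT BOUND, to be typed as a theorem over ALL closed complexes»;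
planner ym-cruxidea-19354-4's `KraftB` brief, CruxIdea4UColumn.lean §4).  Cell `run/shared/lean/pub/ym-instrument/`, HUMAN RULING D-0084 (2), director-ym R138.  HONEST FRAMING
(page 1, binding).  WHAT IS CERTIFIED HERE: PURE COMBINATORICS of finite plaquette sets in `ℤ⁴` — for block parameters `w = (x, y, g)` (`x, y > 0`, `y ≤ 1`, `g ≥ 0` a weight on
link degrees) the block weight is `bwg c m = [2 ≤ c+m]·g(c+m)·x^m·y^c` (a link decided with `c` born and `m` new-born plaquettes has final degree `c + m`); IF the 28 binomial
block inequalities `BlockIneq w : Σ_{m ≤ a} C(a,m)·bwg c m ≤ 1` (`c + a ≤ 6`) hold, then for every admissibility predicate `Adm`, every admissible root `e` and every `n`,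
★ `weightedCount_mul_le`: `(Σ_{X} Π_{ℓ ∈ Adm-links of X} g(deg_X ℓ)) · x^n y^{3n} ≤ G`, the sum over the `Adm`-connected `n`-complexes through `e` closed on their admissible
links (`ClosedComplexTailBound.validFamily`), for any `G` bounding the seven root sums `Σ_{m ≤ a} C(a,m)·bwg 0 m` (`a ≤ 6`); equivalently `Σ_X Π g ≤ G·((x y³)⁻¹)ⁿ`
(`weightedCount_le`).  With `g ≡ 1` this is the landed `admClosedCount_mul_le` (T2′).  The machine (`State`, `und`, `sel`, `step`, `init`, the invariant `Inv` and the counters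
`Φ`, `U`, `μ`) is imported verbatim; only the weights change, and the lower bound along the run picks up exactly `Π_{decided links} g(deg)` because every admissible link of the
target is decided exactly once with all its plaquettes born (`card_atLink_split`).  Instances (rank ∕ Hilbert–Schmidt charges of R″ (d), Catalan parity weights of `KraftB`)
are separate files.  NOT a statement about any gauge theory; no number here moves any endpoint; NOT summit-bearing.  Grade (T).
-/

noncomputable section

open Finset
open Literature.MathematicalPhysics.QuantumLattice (ZdEdge ZdPlaquette plaquetteEdges plaquettesTouching)
open Literature.MathematicalPhysics.QuantumFieldTheory (mem_plaquettesTouching_singleton card_plaquettesTouching_singleton_le card_plaquetteEdges_le)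
open Literature.MathematicalPhysics.QuantumFieldTheory.Balaban1983to89.StrongCouplingKPWindow
open Summit.QuantumFields.YangMills.Theorems.Instrument.AdmissibleLinkComplexCount (IsAdmConnected)
open Summit.QuantumFields.YangMills.Theorems.Instrument.ClosedComplexExploration (atLink State und sel sel_mem step init card_sdiff_add_card_atLink_le)
open Summit.QuantumFields.YangMills.Theorems.Instrument.ClosedComplexTailBound
  (AdmClosed Inv Φ U μ eq_of_terminal inv_step sel_mem_sdiff μ_step U_step Φ_step card_atLink_split inv_init card_links_le Φ_init_le validFamily mem_validFamily
    admClosedCount_eq_card)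

namespace Summit.QuantumFields.YangMills.Theorems.Instrument.ClosedComplexKraftWeighted

/-! ## §1 Block parameters and weighted block weights -/

/-- Block parameters: `x` (new-born plaquette), `y` (already-born plaquette at the decided link), and a nonnegative weight `g` on the final degree of a decided link. [folklore] -/
structure Weights where
  /-- weight of a new-born plaquette -/
  x : ℝ
  /-- weight of an already-born plaquette at the decided link -/
  y : ℝ
  /-- charge on the final degree of the decided link -/
  g : ℕ → ℝ
  /-- positivity of `x` -/
  x_pos : 0 < x
  /-- positivity of `y` -/
  y_pos : 0 < y
  /-- `y ≤ 1` -/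
  y_le_one : y ≤ 1
  /-- `g ≥ 0` -/
  g_nonneg : ∀ k, 0 ≤ g k

/-- Weighted block weight: `[2 ≤ c+m]·g(c+m)·x^m·y^c`. [folklore] -/
def bwg (w : Weights) (c m : ℕ) : ℝ := if 2 ≤ c + m then w.g (c + m) * (w.x ^ m * w.y ^ c) else 0

/-- Block weights are nonnegative. [folklore] -/
theorem bwg_nonneg (w : Weights) (c m : ℕ) : 0 ≤ bwg w c m := by
  unfold bwg; split_ifs
  · exact mul_nonneg (w.g_nonneg _) (mul_nonneg (pow_nonneg w.x_pos.le _) (pow_nonneg w.y_pos.le _))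
  · exact le_rfl

/-- ★ The 28 BLOCK INEQUALITIES in binomial form (the hypothesis of the machine): `Σ_{m ≤ a} C(a,m)·bwg c m ≤ 1` whenever `c + a ≤ 6`. [folklore] -/
def BlockIneq (w : Weights) : Prop := ∀ c a : ℕ, c + a ≤ 6 → ∑ m ∈ range (a + 1), (a.choose m : ℝ) * bwg w c m ≤ 1

/-- A ROOT BOUND: `Σ_{m ≤ a} C(a,m)·bwg 0 m ≤ G` whenever `a ≤ 6`. [folklore] -/
def RootBound (w : Weights) (G : ℝ) : Prop := ∀ a : ℕ, a ≤ 6 → ∑ m ∈ range (a + 1), (a.choose m : ℝ) * bwg w 0 m ≤ G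

/-- Block inequality in powerset form. [folklore] -/
theorem block_powerset {w : Weights} (hB : BlockIneq w) {α : Type*} (A : Finset α) {c : ℕ} (h : A.card + c ≤ 6) : ∑ S ∈ A.powerset, bwg w c S.card ≤ 1 := by
  rw [Finset.sum_powerset_apply_card]
  simp only [nsmul_eq_mul]
  exact hB c A.card (by omega)

/-- Root bound in powerset form. [folklore] -/
theorem root_powerset {w : Weights} {G : ℝ} (hR : RootBound w G) {α : Type*} (A : Finset α) (h : A.card ≤ 6) : ∑ S ∈ A.powerset, bwg w 0 S.card ≤ G := by
  rw [Finset.sum_powerset_apply_card]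
  simp only [nsmul_eq_mul]
  exact hR A.card h

variable (w : Weights) (Adm : ZdEdge 4 → Prop) [DecidablePred Adm]

/-! ## §2 Weighted run weights and the Kraft inequality -/

/-- The weighted run weight towards the target `X` from the state `s` with fuel `k`. [folklore] -/
def wtg : ℕ → State → Finset (ZdPlaquette 4) → ℝ
  | 0, s, X => if und Adm s = ∅ then (if s.Y = X then 1 else 0) else 0
  | k + 1, s, X => if und Adm s = ∅ then (if s.Y = X then 1 else 0) else
      bwg w (atLink s.Y (sel (und Adm s))).card (atLink (X \ s.Y) (sel (und Adm s))).card * wtg k (step Adm s X) X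

/-- Terminal weight. [folklore] -/
theorem wtg_terminal {k : ℕ} {s : State} {X : Finset (ZdPlaquette 4)} (h : und Adm s = ∅) : wtg w Adm k s X = if s.Y = X then 1 else 0 := by
  cases k <;> simp [wtg, h]

/-- One block. [folklore] -/
theorem wtg_succ {k : ℕ} {s : State} {X : Finset (ZdPlaquette 4)} (h : und Adm s ≠ ∅) :
    wtg w Adm (k + 1) s X = bwg w (atLink s.Y (sel (und Adm s))).card (atLink (X \ s.Y) (sel (und Adm s))).card * wtg w Adm k (step Adm s X) X := by
  simp [wtg, h]

/-- **Weighted Kraft inequality** under `BlockIneq`. [folklore] -/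
theorem kraft (hB : BlockIneq w) : ∀ (k : ℕ) (s : State) (𝒳 : Finset (Finset (ZdPlaquette 4))), ∑ X ∈ 𝒳, wtg w Adm k s X ≤ 1 := by
  have hterm : ∀ (k : ℕ) (s : State) (𝒳 : Finset (Finset (ZdPlaquette 4))), und Adm s = ∅ → ∑ X ∈ 𝒳, wtg w Adm k s X ≤ 1 := by
    intro k s 𝒳 h
    simp_rw [wtg_terminal w Adm h]
    rw [sum_ite_eq]
    split_ifs <;> norm_num
  intro k
  induction k with
  | zero =>
    intro s 𝒳
    by_cases h : und Adm s = ∅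
    · exact hterm 0 s 𝒳 h
    · have : ∀ X ∈ 𝒳, wtg w Adm 0 s X = 0 := fun X _ => by simp [wtg, h]
      rw [sum_congr rfl this, sum_const_zero]; exact zero_le_one
  | succ k ih =>
    intro s 𝒳
    by_cases h : und Adm s = ∅
    · exact hterm (k + 1) s 𝒳 h
    · have hrw0 : ∀ X ∈ 𝒳, wtg w Adm (k + 1) s X =
          bwg w (atLink s.Y (sel (und Adm s))).card (atLink (X \ s.Y) (sel (und Adm s))).card *
            wtg w Adm k ⟨s.Y ∪ atLink (X \ s.Y) (sel (und Adm s)), insert (sel (und Adm s)) s.D⟩ X := fun X _ => wtg_succ w Adm h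
      rw [sum_congr rfl hrw0]
      generalize sel (und Adm s) = l
      have hmaps : ∀ X ∈ 𝒳, atLink (X \ s.Y) l ∈ (plaquettesTouching {l} \ s.Y).powerset := by
        intro X _
        rw [mem_powerset]
        intro p hp
        obtain ⟨hp1, hp2⟩ := mem_filter.1 hp
        exact mem_sdiff.2 ⟨mem_plaquettesTouching_singleton.2 hp2, (mem_sdiff.1 hp1).2⟩
      rw [← sum_fiberwise_of_maps_to hmaps]
      have hfib : ∀ S ∈ (plaquettesTouching {l} \ s.Y).powerset,
          ∑ X ∈ 𝒳 with atLink (X \ s.Y) l = S,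
              bwg w (atLink s.Y l).card (atLink (X \ s.Y) l).card * wtg w Adm k ⟨s.Y ∪ atLink (X \ s.Y) l, insert l s.D⟩ X
            ≤ bwg w (atLink s.Y l).card S.card := by
        intro S _
        have hrw : ∀ X ∈ 𝒳.filter (fun X => atLink (X \ s.Y) l = S),
            bwg w (atLink s.Y l).card (atLink (X \ s.Y) l).card * wtg w Adm k ⟨s.Y ∪ atLink (X \ s.Y) l, insert l s.D⟩ X =
              bwg w (atLink s.Y l).card S.card * wtg w Adm k ⟨s.Y ∪ S, insert l s.D⟩ X := by
          intro X hX
          rw [(mem_filter.1 hX).2]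
        rw [sum_congr rfl hrw, ← mul_sum]
        calc bwg w (atLink s.Y l).card S.card * ∑ X ∈ 𝒳 with atLink (X \ s.Y) l = S, wtg w Adm k ⟨s.Y ∪ S, insert l s.D⟩ X
            ≤ bwg w (atLink s.Y l).card S.card * 1 := mul_le_mul_of_nonneg_left (ih _ _) (bwg_nonneg w _ _)
          _ = bwg w (atLink s.Y l).card S.card := mul_one _
      refine (sum_le_sum hfib).trans (block_powerset hB _ ?_)
      have := card_sdiff_add_card_atLink_le s.Y l
      omega

/-- The weighted total weight of the target `X` among `n`-complexes through `e`. [folklore] -/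
def Wg (e : ZdEdge 4) (n : ℕ) (X : Finset (ZdPlaquette 4)) : ℝ := bwg w 0 (atLink X e).card * wtg w Adm (4 * n) (init e X) X

/-- **Weighted Kraft inequality with the root block**: `≤ G`. [folklore] -/
theorem kraft_root_sum (hB : BlockIneq w) {G : ℝ} (hR : RootBound w G) (e : ZdEdge 4) (n : ℕ) (𝒳 : Finset (Finset (ZdPlaquette 4))) :
    ∑ X ∈ 𝒳, Wg w Adm e n X ≤ G := by
  have hmaps : ∀ X ∈ 𝒳, atLink X e ∈ (plaquettesTouching {e}).powerset := by
    intro X _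
    rw [mem_powerset]
    intro p hp
    exact mem_plaquettesTouching_singleton.2 (mem_filter.1 hp).2
  rw [← sum_fiberwise_of_maps_to hmaps]
  have hfib : ∀ S ∈ (plaquettesTouching {e}).powerset, ∑ X ∈ 𝒳 with atLink X e = S, Wg w Adm e n X ≤ bwg w 0 S.card := by
    intro S _
    have hrw : ∀ X ∈ 𝒳.filter (fun X => atLink X e = S), Wg w Adm e n X = bwg w 0 S.card * wtg w Adm (4 * n) ⟨S, {e}⟩ X := by
      intro X hX
      have hS : atLink X e = S := (mem_filter.1 hX).2
      unfold Wg init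
      rw [hS]
    rw [sum_congr rfl hrw, ← mul_sum]
    calc bwg w 0 S.card * ∑ X ∈ 𝒳 with atLink X e = S, wtg w Adm (4 * n) ⟨S, {e}⟩ X
        ≤ bwg w 0 S.card * 1 := mul_le_mul_of_nonneg_left (kraft w Adm hB _ _ _) (bwg_nonneg w _ _)
      _ = bwg w 0 S.card := mul_one _
  exact (sum_le_sum hfib).trans (root_powerset hR _ ((card_plaquettesTouching_singleton_le e).trans (by norm_num)))

/-! ## §3 The lower bound along the actual run: every decided link contributes `g(deg)` -/

/-- The CHARGE still to be collected: the product of `g(deg_X ℓ)` over the admissible links of `X` not yet decided. [folklore] -/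
def charge (X : Finset (ZdPlaquette 4)) (D : Finset (ZdEdge 4)) : ℝ := ∏ l ∈ ((links X).filter Adm \ D), w.g (atLink X l).card

/-- The charge is nonnegative. [folklore] -/
theorem charge_nonneg (X : Finset (ZdPlaquette 4)) (D : Finset (ZdEdge 4)) : 0 ≤ charge w Adm X D := prod_nonneg fun _ _ => w.g_nonneg _

/-- Lower bound along the run: `charge · x^U · y^Φ ≤ wtg · y^U`. [folklore] -/
theorem wtg_lower {e : ZdEdge 4} {X : Finset (ZdPlaquette 4)} (hclosed : AdmClosed Adm X) (hconn : IsAdmConnected Adm X) (hroot : e ∈ links X) :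
    ∀ (k : ℕ) (s : State), Inv e X s → μ Adm X s ≤ k → charge w Adm X s.D * (w.x ^ U X s * w.y ^ Φ X s) ≤ wtg w Adm k s X * w.y ^ U X s := by
  have hterm : ∀ (k : ℕ) (s : State), Inv e X s → und Adm s = ∅ →
      charge w Adm X s.D * (w.x ^ U X s * w.y ^ Φ X s) ≤ wtg w Adm k s X * w.y ^ U X s := by
    intro k s hI h
    have hYX : s.Y = X := eq_of_terminal Adm hI hconn hroot h
    have hU : U X s = 0 := by unfold U; rw [hYX, Finset.sdiff_self, card_empty]
    have hch : charge w Adm X s.D = 1 := by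
      unfold charge
      have : (links X).filter Adm \ s.D = ∅ := by rw [← hYX]; exact h
      rw [this, prod_empty]
    rw [wtg_terminal w Adm h, if_pos hYX, hU, hch, pow_zero, pow_zero, one_mul, one_mul, one_mul]
    exact pow_le_one₀ w.y_pos.le w.y_le_one
  intro k
  induction k with
  | zero =>
    intro s hI hμ
    by_cases h : und Adm s = ∅
    · exact hterm 0 s hI h
    · exfalso
      have : 0 < μ Adm X s := card_pos.2 ⟨_, sel_mem_sdiff Adm hI h⟩
      omega
  | succ k ih =>
    intro s hI hμ
    by_cases h : und Adm s = ∅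
    · exact hterm (k + 1) s hI h
    · have hμ' : μ Adm X (step Adm s X) ≤ k := by have := μ_step Adm hI h; omega
      have hI' := inv_step Adm hI (X := X)
      have hrec := ih (step Adm s X) hI' hμ'
      have hsel := sel_mem_sdiff Adm hI h
      set l := sel (und Adm s) with hl
      set c := (atLink s.Y l).card with hc
      set m := (atLink (X \ s.Y) l).card with hm
      have hsplit : (atLink X l).card = c + m := by rw [hc, hm]; exact card_atLink_split hI l
      have hdeg : 2 ≤ c + m := by
        rw [← hsplit]
        have hsel' := mem_sdiff.1 hsel
        exact hclosed l (mem_filter.1 hsel'.1).1 (mem_filter.1 hsel'.1).2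
      have hbw : bwg w c m = w.g (c + m) * (w.x ^ m * w.y ^ c) := by unfold bwg; rw [if_pos hdeg]
      have hU : U X s = m + U X (step Adm s X) := U_step Adm
      have hΦ : Φ X s = (c + m) + Φ X (step Adm s X) := by rw [Φ_step Adm hI h, card_atLink_split hI l]
      -- the charge loses exactly the factor `g(deg l) = g(c+m)` at this block
      have hD : (step Adm s X).D = insert l s.D := rfl
      have hch : charge w Adm X s.D = w.g (c + m) * charge w Adm X (step Adm s X).D := by
        unfold charge
        rw [hD, sdiff_insert, ← mul_prod_erase _ _ hsel, hsplit]
      rw [wtg_succ w Adm h, ← hl, ← hc, ← hm, hbw, hU, hΦ, hch]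
      have hx := w.x_pos
      have hy := w.y_pos
      have hg := w.g_nonneg (c + m)
      have hchn := charge_nonneg w Adm X (step Adm s X).D
      calc w.g (c + m) * charge w Adm X (step Adm s X).D * (w.x ^ (m + U X (step Adm s X)) * w.y ^ (c + m + Φ X (step Adm s X)))
          = (w.g (c + m) * (w.x ^ m * w.y ^ c) * w.y ^ m) *
              (charge w Adm X (step Adm s X).D * (w.x ^ U X (step Adm s X) * w.y ^ Φ X (step Adm s X))) := by ring
        _ ≤ (w.g (c + m) * (w.x ^ m * w.y ^ c) * w.y ^ m) * (wtg w Adm k (step Adm s X) X * w.y ^ U X (step Adm s X)) :=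
            mul_le_mul_of_nonneg_left hrec (by positivity)
        _ = w.g (c + m) * (w.x ^ m * w.y ^ c) * wtg w Adm k (step Adm s X) X * w.y ^ (m + U X (step Adm s X)) := by ring

/-- ★ The weighted weight of an admissible `n`-complex through the admissible root link: `(Π_{ℓ Adm} g(deg ℓ))·x^n y^{3n} ≤ Wg`. [folklore] -/
theorem Wg_lower {e : ZdEdge 4} (he : Adm e) {n : ℕ} {X : Finset (ZdPlaquette 4)} (hcard : X.card = n) (hroot : e ∈ links X)
    (hconn : IsAdmConnected Adm X) (hclosed : AdmClosed Adm X) :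
    charge w Adm X ∅ * (w.x ^ n * w.y ^ (3 * n)) ≤ Wg w Adm e n X := by
  have hx := w.x_pos
  have hy := w.y_pos
  set m₀ := (atLink X e).card with hm₀
  have hm₀n : m₀ ≤ n := hcard ▸ card_le_card (filter_subset _ _)
  have hdeg : 2 ≤ 0 + m₀ := by rw [zero_add]; exact hclosed _ hroot he
  have hbw : bwg w 0 m₀ = w.g m₀ * w.x ^ m₀ := by unfold bwg; rw [if_pos hdeg, zero_add, pow_zero, mul_one]
  have hg0 := w.g_nonneg m₀
  have hU : U X (init e X) = n - m₀ := by
    unfold U init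
    rw [card_sdiff_of_subset (filter_subset _ _), hcard]
  have hμ : μ Adm X (init e X) ≤ 4 * n := by
    have h4 : (links X).card ≤ 4 * n := by rw [← hcard]; exact card_links_le X
    unfold μ
    exact (card_le_card sdiff_subset).trans ((card_le_card (filter_subset _ _)).trans h4)
  have hΦ : Φ X (init e X) ≤ 3 * n + (n - m₀) := by
    have := Φ_init_le e X
    rw [hcard, ← hm₀] at this
    omega
  -- the root block collects `g(m₀)`: `charge X ∅ = g(m₀) · charge X {e}`
  have he_mem : e ∈ (links X).filter Adm := mem_filter.2 ⟨hroot, he⟩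
  have hch : charge w Adm X ∅ = w.g m₀ * charge w Adm X (init e X).D := by
    unfold charge init
    rw [sdiff_empty, ← mul_prod_erase _ _ he_mem, ← sdiff_singleton_eq_erase]
  have hrun := wtg_lower w Adm hclosed hconn hroot (4 * n) (init e X) (inv_init e X) hμ
  rw [hU] at hrun
  have hchn := charge_nonneg w Adm X (init e X).D
  have h1 : charge w Adm X (init e X).D * (w.x ^ (n - m₀) * w.y ^ (3 * n + (n - m₀))) ≤ wtg w Adm (4 * n) (init e X) X * w.y ^ (n - m₀) :=
    (mul_le_mul_of_nonneg_left (mul_le_mul_of_nonneg_left (pow_le_pow_of_le_one hy.le w.y_le_one hΦ) (by positivity)) hchn).trans hrun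
  have h2 : (charge w Adm X ∅ * (w.x ^ n * w.y ^ (3 * n))) * w.y ^ (n - m₀) ≤ Wg w Adm e n X * w.y ^ (n - m₀) := by
    unfold Wg
    rw [← hm₀, hbw, hch]
    have hxn : w.x ^ n = w.x ^ m₀ * w.x ^ (n - m₀) := by rw [← pow_add, Nat.add_sub_cancel' hm₀n]
    calc w.g m₀ * charge w Adm X (init e X).D * (w.x ^ n * w.y ^ (3 * n)) * w.y ^ (n - m₀)
        = (w.g m₀ * w.x ^ m₀) * (charge w Adm X (init e X).D * (w.x ^ (n - m₀) * w.y ^ (3 * n + (n - m₀)))) := by rw [hxn, pow_add]; ring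
      _ ≤ (w.g m₀ * w.x ^ m₀) * (wtg w Adm (4 * n) (init e X) X * w.y ^ (n - m₀)) := mul_le_mul_of_nonneg_left h1 (by positivity)
      _ = w.g m₀ * w.x ^ m₀ * wtg w Adm (4 * n) (init e X) X * w.y ^ (n - m₀) := by ring
  exact le_of_mul_le_mul_right h2 (by positivity)

/-! ## §4 ★ The weighted count bound -/

/-- The DEGREE-CHARGED SUM over the admissible `n`-complexes through `e`: `Σ_X Π_{ℓ ∈ Adm-links of X} g(deg_X ℓ)`. [folklore] -/
def weightedCount (e : ZdEdge 4) (n : ℕ) : ℝ := ∑ X ∈ validFamily Adm e n, charge w Adm X ∅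

/-- The charge of `X` with nothing decided is the full product `Π_{ℓ ∈ Adm-links of X} g(deg_X ℓ)`. [folklore] -/
theorem charge_empty (X : Finset (ZdPlaquette 4)) : charge w Adm X ∅ = ∏ l ∈ (links X).filter Adm, w.g (atLink X l).card := by
  unfold charge; rw [sdiff_empty]

/-- ★★ **THE DEGREE-CHARGED KRAFT BOUND**: under the 28 block inequalities and a root bound `G`, `(Σ_X Π g(deg)) · x^n y^{3n} ≤ G` through every admissible root. [folklore] -/
theorem weightedCount_mul_le (hB : BlockIneq w) {G : ℝ} (hR : RootBound w G) {e : ZdEdge 4} (he : Adm e) (n : ℕ) :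
    weightedCount w Adm e n * (w.x ^ n * w.y ^ (3 * n)) ≤ G := by
  unfold weightedCount
  rw [sum_mul]
  refine (sum_le_sum fun X hX => ?_).trans (kraft_root_sum w Adm hB hR e n (validFamily Adm e n))
  obtain ⟨hcard, hroot, hconn, hclosed⟩ := (mem_validFamily Adm).1 hX
  exact Wg_lower w Adm he hcard hroot hconn hclosed

/-- ★★ The same, divided: `Σ_X Π g(deg) ≤ G · ((x·y³)⁻¹)ⁿ`. [folklore] -/
theorem weightedCount_le (hB : BlockIneq w) {G : ℝ} (hR : RootBound w G) {e : ZdEdge 4} (he : Adm e) (n : ℕ) :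
    weightedCount w Adm e n ≤ G * ((w.x * w.y ^ 3)⁻¹) ^ n := by
  have h := weightedCount_mul_le w Adm hB hR he n
  have hx := w.x_pos
  have hy := w.y_pos
  have hxy : w.x ^ n * w.y ^ (3 * n) = (((w.x * w.y ^ 3)⁻¹) ^ n)⁻¹ := by
    rw [inv_pow, inv_inv, mul_pow, ← pow_mul, mul_comm 3 n]
  rw [hxy] at h
  rwa [← div_eq_mul_inv, div_le_iff₀ (by positivity)] at h

end Summit.QuantumFields.YangMills.Theorems.Instrument.ClosedComplexKraftWeighted

end
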